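import Summits.QuantumFields.BalabanUV.Beta.FP.TowerFTransportRow

/-!
# `BalabanUV.Beta.FP.TowerFTransportRowW` — road «FP», binder row D1, ROUTE T, the (H5-F) option (3a) (road `g61/JUNCTION-F.md` §3 (3); an2 g84 RCPT-4 ∕ W-8): **THE END's
# TRANSPORT ROW `htr` FOR ANY EXPONENTIALLY LOCALISED STEP WEIGHT FAMILY** — `TowerFTransportRow` §2–§3 (road g58, p737911) with the straight step column `wStep Lc (j+1)` replaced by
# a weight family `w j : EKer 4` displayed with ONE letter `hwloc j : ∃ δ C, 0 < δ ∧ 0 ≤ C ∧ |w j κ l p| ≤ C·e^{−δ|p|₁}` (the shape of g58's `abs_wStep_le`)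

WHY (journal l.69153 an2 RCPT-4 (3a), l.69163 W-8; road A-4 l.69160).  By value (Engine C R-AN2-84-HQF0) the tower's top-step response column is `3⁻⁵·wStep + dξ` (an exact gauge
mode added); option (3a) dresses the END's F-family by the true weight `wFRec` (an2 PART 96, the successor row seat's `Beta/FP/TowerFWeightRecDefs`), so the END's `htr` must be
available at a weight other than `wStep`.  g58's proof uses `wStep` ONLY through the decay letter `abs_wStep_le`; THIS FILE displays that letter for a generic `w` and repeats the
two proofs token for token (generator: `wStep Lc (j + 1) ↦ w j` ×13, `abs_wStep_le Lc (j + 1) ↦ hwloc j` ×2, names `… ↦ …_w`; §1's record letters `shiftK_AN_smul ∕ VN_translate ∕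
WN_translate` imported BY NAME).  With `w j := wFRec … j` the conclusion reads `… = Lc^8 · dressedEntry (wFRec … j) (hessKer (AN ctr j) (VN j) (WN j)) (Lc•z)`, and the END
consumer's `htr` (literal: `dressedEntry (wStep Lc (j+1)) …`) follows from the ONE displayed junction `hWT` (dressing invariance of the composite one-loop kernel — by value
R-FP-61-WARD; the divergence-form algebra is road `FP/DressedEntryWeightAlgebra`).

WHAT ([folklore] composition BY NAME; no `def`, no `def … : Prop`, nothing cited, 0 sorry): §1 **`htr_rec_w`**; §2 **`exists_vertexFamilies_FRec_w`**.
WHAT THIS IS NOT: not the weight `wFRec` (PART 96) nor its letter (Lw) (which IS `hwloc`); not `hWT`; nothing of Bałaban's asserted, valued or discharged; 0 estimates; 0∕4 row-D1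
binders (hW, hR, D1Tel, D1Rep); NOT (C1), NOT (T-ID), NOT D1, NEVER «G-an2-4 closed», NOT BetaPertH, NOT continuum, NOT Clay.

HONEST DEPENDENCY (page 1, mandatory): continuum YM on T⁴ ⇐ BetaPertH ∧ nine spine estimates (0/9 proved); BetaPertH ⇐ (D1) ∧ (D4) ∧ CAP+tail;
G-an2-4 gates asym, D1 and NE2/3/4.  HONEST FRAMING (cell contract, verbatim): «discharging `BetaPertH` makes Bałaban's UV stability UNCONDITIONAL —
a real constructive-QFT result; it is NOT the continuum limit and NOT the Clay problem.»  ABSOLUTE RULE (cell charter, verbatim): «No internally-minted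
statement may enter as a cited fact. Every hypothesis is either kernel-proved in this package or a verbatim quotation of a PUBLISHED theorem with page
reference. The manuscript(s) under audit are NOT citable for their own disputed steps — they are the thing under adjudication; programme-internal
(2001/route/tribunal) claims are never citable.»  Road «FP» OWNER, b2b-balaban-beta-d1-p3 gen 61, 2026-08-30.  No existing file touched.
-/

noncomputable section

open scoped BigOperators

namespace Summit.QuantumFields.BalabanUV.Beta.FP.TowerFTransportRowW

open Finset
open Literature.MathematicalPhysics.QuantumFieldTheory
open Literature.MathematicalPhysics.QuantumFieldTheory.Balaban1983to89
open Literature.MathematicalPhysics.QuantumFieldTheory.Balaban1983to89.Beta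
open B12Sec2to5 (l1 l1_nonneg)
open ExpKernelCalculus (Site MKer Decays BiLoc VertexFamily VertexFamily₂ shiftK hessKer bubble tadpole)
open DressedMomentNormalisation (EKer dressedEntry)
open HessKerRate (scaleK hessKer_scaleK biLoc_scaleK)
open SecondOrderResponse (biLoc_smul)
open KernelReflection (bubble_smul_left bubble_smul_right tadpole_smul)
open HessianTelescopingKKT (wStep)
open OneStepResolventKernel (Fib)
open OneStepKernelFamily (KInvStep decays_KInvStep)
open BalabanStepJetsSucc (vertexOfK_translate_block)
open Summit.QuantumFields.BalabanUV.Beta.TameKernelCalculus (Spr biLoc_of_le)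
open Summit.QuantumFields.BalabanUV.Beta.AxialDressingRooted (one_le_of_neZero)
open Summit.QuantumFields.BalabanUV.Beta.CompositeOneShotJets (tabsComp)
open Summit.QuantumFields.BalabanUV.Beta.CompositeOneShotJetData (Roots Pins AN VN WN AN_eq VN_eq WN_eq JNat JNat_S JNat_W)
open Summit.QuantumFields.BalabanUV.Beta.NVertexSectors (decays_AN)
open Summit.QuantumFields.BalabanUV.Beta.NVertexWoundPeriodised (shiftK_AN)
open Summit.QuantumFields.BalabanUV.Beta.NVertexParities (vertexFamilies_VN_WN)
open Summit.QuantumFields.BalabanUV.Beta.ChartStepJets (SchartOf_translate WchartOf_translate)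
open Summit.QuantumFields.BalabanUV.Beta.FP.NestedConstraintScaling (fibreScale_mul_inv)
open Summit.QuantumFields.BalabanUV.Beta.FP.KernelStepDressing (dressV dressW vertexFamily_dressV vertexFamily₂_dressW)
open Summit.QuantumFields.BalabanUV.Beta.FP.TowerSigmaLegLetters (abs_fibSigma'_le)
open Summit.QuantumFields.BalabanUV.Beta.FP.KernelStepDressingHessKer (hessKer_dressV_dressW)
open Summit.QuantumFields.BalabanUV.Beta.FP.TowerFTransportRow (shiftK_AN_smul VN_translate WN_translate)

/-! ## §1 THE TRANSPORT ROW AT THE RECORD, FOR ANY EXPONENTIALLY LOCALISED STEP WEIGHT FAMILY `w` -/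

section Record

variable (Lc : ℕ) [NeZero Lc] (Pn : Pins) (uF : ℕ → ℝ) (w : ℕ → EKer (3 + 1))
  (hwloc : ∀ j : ℕ, ∃ δ C : ℝ, 0 < δ ∧ 0 ≤ C ∧ ∀ (κ l : Fin (3 + 1)) (p : Fin (3 + 1) → ℤ), |w j κ l p| ≤ C * Real.exp (-δ * l1 p))

include hwloc in
/-- [folklore] **`htr` AT THE RECORD FOR ANY STEP WEIGHT FAMILY `w`** — `TowerFTransportRow.htr_rec` (v10's binder `htr` CHARACTER FOR CHARACTER under its σ) with
`wStep Lc (j+1) ↦ w j` in `𝒱F ∕ 𝒲F` AND on the right (`dressedEntry (w j) …`): the units cancel, and FILE 2's `hessKer_dressV_dressW` at `w := w j` fed `hwloc j` + the record's letters is the row.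
(Option (3a): at `w j := wFRec … j` (an2 PART 96) this is the END's `htr` up to the displayed dressing-invariance junction `hWT`; at `w j := wStep Lc (j+1)` it is g58's `htr_rec`.) -/
theorem htr_rec_w (huF : ∀ j, uF j ≠ 0) : ∀ j : ℕ, 1 ≤ j → ∀ (μ ν : Fin 4) (z : Fin 4 → ℤ), hessKer (scaleK (Sum.elim (fun _ : Fin (3 + 1) => (1 : ℝ)) (fun _ : Fin (3 + 1) => (uF j)⁻¹)) (Sum.elim (fun _ : Fin (3 + 1) => (1 : ℝ)) (fun _ : Fin (3 + 1) => (uF j)⁻¹)) (AN (Roots.ctr Lc) j)) (fun μ y => scaleK (Sum.elim (fun _ : Fin (3 + 1) => (1 : ℝ)) (fun _ : Fin (3 + 1) => (uF j))) (Sum.elim (fun _ : Fin (3 + 1) => (1 : ℝ)) (fun _ : Fin (3 + 1) => (uF j))) ((Lc : ℝ) ^ 4 • dressV (Lc ^ (j + 1)) Lc (w j) (VN (Roots.ctr Lc) Pn j) μ y)) (fun μ y ν y' => scaleK (Sum.elim (fun _ : Fin (3 + 1) => (1 : ℝ)) (fun _ : Fin (3 + 1) => (uF j))) (Sum.elim (fun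 _ : Fin (3 + 1) => (1 : ℝ)) (fun _ : Fin (3 + 1) => (uF j))) ((Lc : ℝ) ^ 8 • dressW (Lc ^ (j + 1)) Lc (w j) (WN (Roots.ctr Lc) Pn j) μ y ν y')) μ ν z = (Lc : ℝ) ^ 8 * dressedEntry (w j) (hessKer (AN (Roots.ctr Lc) j) (VN (Roots.ctr Lc) Pn j) (WN (Roots.ctr Lc) Pn j)) ((Lc : ℤ) • z) μ ν := by
  intro j _ μ ν z
  have hσσ : ∀ a : Fib 3, Sum.elim (fun _ : Fin (3 + 1) => (1 : ℝ)) (fun _ : Fin (3 + 1) => (uF j)⁻¹) a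
      * Sum.elim (fun _ : Fin (3 + 1) => (1 : ℝ)) (fun _ : Fin (3 + 1) => (uF j)) a = 1 := fun a => fibreScale_mul_inv (huF j) a
  rw [hessKer_scaleK _ _ hσσ (AN (Roots.ctr Lc) j)
    (fun μ y => (Lc : ℝ) ^ 4 • dressV (Lc ^ (j + 1)) Lc (w j) (VN (Roots.ctr Lc) Pn j) μ y)
    (fun μ y ν y' => (Lc : ℝ) ^ 8 • dressW (Lc ^ (j + 1)) Lc (w j) (WN (Roots.ctr Lc) Pn j) μ y ν y')]
  -- the record's letters
  obtain ⟨δA, CA, hδA, -, hA⟩ := decays_AN (Roots.ctr Lc) j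
  obtain ⟨Cv, Cw, δ, hδ, hV, hW⟩ := vertexFamilies_VN_WN (Roots.ctr Lc) Pn j
  obtain ⟨δw, Cw0, hδw, hCw0, hw⟩ := hwloc j
  have hid := hessKer_dressV_dressW (N := Lc ^ (j + 1)) Lc (w := w j) (A := AN (Roots.ctr Lc) j)
    (V := VN (Roots.ctr Lc) Pn j) (W := WN (Roots.ctr Lc) Pn j) ⟨CA, δA, hδA, hA⟩ (shiftK_AN_smul Lc (Roots.ctr Lc) j)
    (fun c a u => hw c a u) hCw0 hδw hV hW hδ (VN_translate Lc (Roots.ctr Lc) Pn j) (WN_translate Lc (Roots.ctr Lc) Pn j) μ ν z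
  rw [← hid]
  simp only [ExpKernelCalculus.hessKer]
  rw [tadpole_smul, bubble_smul_left, bubble_smul_right]
  ring

end Record

/-! ## §2 The `w`-dressed F-families ARE vertex families at blocking `Lc^(j+1)·Lc` (`∃`-form) -/

section Families

variable (Lc : ℕ) [NeZero Lc] (Pn : Pins) (uF : ℕ → ℝ) (w : ℕ → EKer (3 + 1))
  (hwloc : ∀ j : ℕ, ∃ δ C : ℝ, 0 < δ ∧ 0 ≤ C ∧ ∀ (κ l : Fin (3 + 1)) (p : Fin (3 + 1) → ℤ), |w j κ l p| ≤ C * Real.exp (-δ * l1 p))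

include hwloc in
/-- [folklore] **THE σ′-SCALED `w`-DRESSED FAMILIES ARE VERTEX FAMILIES** at blocking `Lc^(j+1)·Lc` with ONE common rate (`TowerFTransportRow.exists_vertexFamilies_FRec` with
`wStep Lc (j+1) ↦ w j`: FILE 1 §3 fed an2 `vertexFamilies_VN_WN` and `hwloc j`, `biLoc_smul`, `biLoc_scaleK`). -/
theorem exists_vertexFamilies_FRec_w (huF : ∀ j, 1 ≤ uF j) (j : ℕ) : ∃ Cv Cw δ : ℝ, 0 < δ ∧
    VertexFamily (fun μ y => scaleK (Sum.elim (fun _ : Fin (3 + 1) => (1 : ℝ)) (fun _ : Fin (3 + 1) => (uF j))) (Sum.elim (fun _ : Fin (3 + 1) => (1 : ℝ)) (fun _ : Fin (3 + 1) => (uF j))) ((Lc : ℝ) ^ 4 • dressV (Lc ^ (j + 1)) Lc (w j) (VN (Roots.ctr Lc) Pn j) μ y)) (Lc ^ (j + 1) * Lc) Cv δ ∧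
    VertexFamily₂ (fun μ y ν y' => scaleK (Sum.elim (fun _ : Fin (3 + 1) => (1 : ℝ)) (fun _ : Fin (3 + 1) => (uF j))) (Sum.elim (fun _ : Fin (3 + 1) => (1 : ℝ)) (fun _ : Fin (3 + 1) => (uF j))) ((Lc : ℝ) ^ 8 • dressW (Lc ^ (j + 1)) Lc (w j) (WN (Roots.ctr Lc) Pn j) μ y ν y')) (Lc ^ (j + 1) * Lc) Cw δ := by
  obtain ⟨Cv, Cw, δ, hδ, hV, hW⟩ := vertexFamilies_VN_WN (Roots.ctr Lc) Pn j
  obtain ⟨δw, Cw0, hδw, hCw0, hw⟩ := hwloc j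
  have hV' := vertexFamily_dressV (N := Lc ^ (j + 1)) Lc (w := w j) (fun c a u => hw c a u) hCw0 hδw hV hδ
  have hW' := vertexFamily₂_dressW (N := Lc ^ (j + 1)) Lc (w := w j) (fun c a u => hw c a u) hCw0 hδw hW hδ
  have hNpos : (0 : ℝ) < ((Lc ^ (j + 1) : ℕ) : ℝ) := by exact_mod_cast Nat.pos_of_ne_zero (NeZero.ne (Lc ^ (j + 1)))
  have hm : 0 < min (δw / ((Lc ^ (j + 1) : ℕ) : ℝ)) δ := lt_min (div_pos hδw hNpos) hδ
  have hs := fun a => abs_fibSigma'_le (d := 3) (huF j) a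
  have hle : min (δw / ((Lc ^ (j + 1) : ℕ) : ℝ)) δ / 2 / 2 ≤ min (δw / ((Lc ^ (j + 1) : ℕ) : ℝ)) δ / 2 := by linarith [half_pos hm]
  have hV'' : VertexFamily (fun μ y => scaleK (Sum.elim (fun _ : Fin (3 + 1) => (1 : ℝ)) (fun _ : Fin (3 + 1) => (uF j)))
      (Sum.elim (fun _ : Fin (3 + 1) => (1 : ℝ)) (fun _ : Fin (3 + 1) => (uF j)))
      ((Lc : ℝ) ^ 4 • dressV (Lc ^ (j + 1)) Lc (w j) (VN (Roots.ctr Lc) Pn j) μ y)) (Lc ^ (j + 1) * Lc)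
      (uF j * (|(Lc : ℝ) ^ 4| * |∑ _c : Fin (3 + 1), Cw0 * |Cv| * ExpKernelCalculus.Zl (3 + 1) (min (δw / ((Lc ^ (j + 1) : ℕ) : ℝ)) δ / 2)|) * uF j)
      (min (δw / ((Lc ^ (j + 1) : ℕ) : ℝ)) δ / 2 / 2) :=
    fun μ y => biLoc_scaleK hs hs (biLoc_smul ((Lc : ℝ) ^ 4) (biLoc_of_le (hV' μ y) hle))
  have hW'' : VertexFamily₂ (fun μ y ν y' => scaleK (Sum.elim (fun _ : Fin (3 + 1) => (1 : ℝ)) (fun _ : Fin (3 + 1) => (uF j)))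
      (Sum.elim (fun _ : Fin (3 + 1) => (1 : ℝ)) (fun _ : Fin (3 + 1) => (uF j)))
      ((Lc : ℝ) ^ 8 • dressW (Lc ^ (j + 1)) Lc (w j) (WN (Roots.ctr Lc) Pn j) μ y ν y')) (Lc ^ (j + 1) * Lc)
      (uF j * (|(Lc : ℝ) ^ 8| * (∑ _c : Fin (3 + 1), ∑ _e : Fin (3 + 1),
        Cw0 * (Cw0 * |Cw| * ExpKernelCalculus.Zl (3 + 1) (min (δw / ((Lc ^ (j + 1) : ℕ) : ℝ)) δ / 2))
          * ExpKernelCalculus.Zl (3 + 1) (min (δw / ((Lc ^ (j + 1) : ℕ) : ℝ)) δ / 2 / 2))) * uF j)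
      (min (δw / ((Lc ^ (j + 1) : ℕ) : ℝ)) δ / 2 / 2) :=
    fun μ y ν y' => biLoc_scaleK hs hs (biLoc_smul ((Lc : ℝ) ^ 8) (hW' μ y ν y'))
  exact ⟨_, _, _, half_pos (half_pos hm), hV'', hW''⟩

end Families

end Summit.QuantumFields.BalabanUV.Beta.FP.TowerFTransportRowW

end
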